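import Mathlib
import Literature.Analysis.Calculus.IntervalCauchySchwarz
import Literature.Analysis.Approximation.CoefficientBound

/-!
# The energy norm on a set is a seminorm (Minkowski for `∫ u₁² + u₂² + u₃²`)

Analysis/PDE support file (everything proved, no definitions). For continuous functions
`uᵢ, vᵢ : ℝ → ℝ` (`i = 1,2,3`) whose squares are integrable on a measurable set `S`,

  `√(∫_S Σᵢ (uᵢ + vᵢ)²) ≤ √(∫_S Σᵢ uᵢ²) + √(∫_S Σᵢ vᵢ²)`        (`sqrt_integral_sum_sq_add_le`),

proved by the `λ`-trick `2uv ≤ λu² + v²/λ` and `Literature.Analysis.Calculus.le_sqrt_mul_sqrt_of_forall_pos`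
(no `L²` space is invoked). Specialised to `u = (h₁', √W h₁, g₁)`, `v = (h₂', √W h₂, g₂)` this is the
triangle inequality for the square root of the wave energy `∫_S h'² + W h² + g²` of Cauchy data
(`sqrt_energy_add_le`), used for the energy (semi)norm on far half-lines and for the fact that
subtracting a non-radiating solution does not increase channel energies (route PhotonSphereChannels,
`FixedModeChannels`, far side, stmt-FinalStateConjecture-10048). Folklore.
-/

noncomputable section

namespace Literature.Analysis.PDE

open Set MeasureTheory Literature.Analysis.Calculus Literature.Analysis.Approximation

/-- Squares of sums of continuous functions with integrable squares are integrable. [folklore] -/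
theorem integrableOn_add_sq {f g : ℝ → ℝ} (hf : Continuous f) (hg : Continuous g)
    {S : Set ℝ} (hf2 : IntegrableOn (fun x => f x ^ 2) S) (hg2 : IntegrableOn (fun x => g x ^ 2) S) :
    IntegrableOn (fun x => (f x + g x) ^ 2) S := by
  have : (fun x => (f x + g x) ^ 2) = fun x => f x ^ 2 + 2 * (f x * g x) + g x ^ 2 := by
    funext x; ring
  rw [this]
  exact (hf2.add ((integrableOn_mul_of_sq hf hg hf2 hg2).const_mul 2)).add hg2

/-- **Minkowski for three-component square integrals.** See the module docstring. [folklore] -/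
theorem sqrt_integral_sum_sq_add_le {u₁ u₂ u₃ v₁ v₂ v₃ : ℝ → ℝ} (hu₁ : Continuous u₁)
    (hu₂ : Continuous u₂) (hu₃ : Continuous u₃) (hv₁ : Continuous v₁) (hv₂ : Continuous v₂)
    (hv₃ : Continuous v₃) {S : Set ℝ} (hS : MeasurableSet S)
    (iu₁ : IntegrableOn (fun x => u₁ x ^ 2) S) (iu₂ : IntegrableOn (fun x => u₂ x ^ 2) S)
    (iu₃ : IntegrableOn (fun x => u₃ x ^ 2) S) (iv₁ : IntegrableOn (fun x => v₁ x ^ 2) S)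
    (iv₂ : IntegrableOn (fun x => v₂ x ^ 2) S) (iv₃ : IntegrableOn (fun x => v₃ x ^ 2) S) :
    IntegrableOn (fun x => (u₁ x + v₁ x) ^ 2 + (u₂ x + v₂ x) ^ 2 + (u₃ x + v₃ x) ^ 2) S ∧
    Real.sqrt (∫ x in S, ((u₁ x + v₁ x) ^ 2 + (u₂ x + v₂ x) ^ 2 + (u₃ x + v₃ x) ^ 2))
      ≤ Real.sqrt (∫ x in S, (u₁ x ^ 2 + u₂ x ^ 2 + u₃ x ^ 2))
        + Real.sqrt (∫ x in S, (v₁ x ^ 2 + v₂ x ^ 2 + v₃ x ^ 2)) := by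
  have hsum : IntegrableOn (fun x => (u₁ x + v₁ x) ^ 2 + (u₂ x + v₂ x) ^ 2 + (u₃ x + v₃ x) ^ 2) S :=
    ((integrableOn_add_sq hu₁ hv₁ iu₁ iv₁).add (integrableOn_add_sq hu₂ hv₂ iu₂ iv₂)).add
      (integrableOn_add_sq hu₃ hv₃ iu₃ iv₃)
  refine ⟨hsum, ?_⟩
  set A : ℝ := ∫ x in S, (u₁ x ^ 2 + u₂ x ^ 2 + u₃ x ^ 2) with hA
  set B : ℝ := ∫ x in S, (v₁ x ^ 2 + v₂ x ^ 2 + v₃ x ^ 2) with hB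
  set P : ℝ := ∫ x in S, (u₁ x * v₁ x + u₂ x * v₂ x + u₃ x * v₃ x) with hP
  have iA : IntegrableOn (fun x => u₁ x ^ 2 + u₂ x ^ 2 + u₃ x ^ 2) S := (iu₁.add iu₂).add iu₃
  have iB : IntegrableOn (fun x => v₁ x ^ 2 + v₂ x ^ 2 + v₃ x ^ 2) S := (iv₁.add iv₂).add iv₃
  have iP : IntegrableOn (fun x => u₁ x * v₁ x + u₂ x * v₂ x + u₃ x * v₃ x) S :=
    ((integrableOn_mul_of_sq hu₁ hv₁ iu₁ iv₁).add
      (integrableOn_mul_of_sq hu₂ hv₂ iu₂ iv₂)).add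
      (integrableOn_mul_of_sq hu₃ hv₃ iu₃ iv₃)
  have hA0 : 0 ≤ A := setIntegral_nonneg hS fun x _ => by positivity
  have hB0 : 0 ≤ B := setIntegral_nonneg hS fun x _ => by positivity
  -- the expansion `∫(u+v)² = A + B + 2P`
  have hexp : ∫ x in S, ((u₁ x + v₁ x) ^ 2 + (u₂ x + v₂ x) ^ 2 + (u₃ x + v₃ x) ^ 2)
      = A + B + 2 * P := by
    have : (fun x => (u₁ x + v₁ x) ^ 2 + (u₂ x + v₂ x) ^ 2 + (u₃ x + v₃ x) ^ 2)
        = fun x => (u₁ x ^ 2 + u₂ x ^ 2 + u₃ x ^ 2) + (v₁ x ^ 2 + v₂ x ^ 2 + v₃ x ^ 2)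
          + 2 * (u₁ x * v₁ x + u₂ x * v₂ x + u₃ x * v₃ x) := by
      funext x; ring
    have iAB : IntegrableOn (fun x => (u₁ x ^ 2 + u₂ x ^ 2 + u₃ x ^ 2)
        + (v₁ x ^ 2 + v₂ x ^ 2 + v₃ x ^ 2)) S := iA.add iB
    have iP2 : IntegrableOn (fun x => 2 * (u₁ x * v₁ x + u₂ x * v₂ x + u₃ x * v₃ x)) S :=
      iP.const_mul 2
    rw [this, integral_add iAB iP2, integral_add iA iB, MeasureTheory.integral_const_mul]
  -- `2P ≤ λA + B/λ`, hence `P ≤ √A √B`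
  have hPle : P ≤ Real.sqrt A * Real.sqrt B := by
    refine le_sqrt_mul_sqrt_of_forall_pos hA0 hB0 fun lam hlam => ?_
    have hpt : ∀ x, 2 * (u₁ x * v₁ x + u₂ x * v₂ x + u₃ x * v₃ x)
        ≤ lam * (u₁ x ^ 2 + u₂ x ^ 2 + u₃ x ^ 2) + (v₁ x ^ 2 + v₂ x ^ 2 + v₃ x ^ 2) / lam := by
      intro x
      have key : ∀ a b : ℝ, 2 * (a * b) ≤ lam * a ^ 2 + b ^ 2 / lam := by
        intro a b
        have h := sq_nonneg (lam * a - b)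
        have e : (lam * a - b) ^ 2 / lam = lam * a ^ 2 + b ^ 2 / lam - 2 * (a * b) := by
          field_simp; ring
        have : 0 ≤ (lam * a - b) ^ 2 / lam := div_nonneg h hlam.le
        linarith
      have k1 := key (u₁ x) (v₁ x)
      have k2 := key (u₂ x) (v₂ x)
      have k3 := key (u₃ x) (v₃ x)
      have e : lam * (u₁ x ^ 2 + u₂ x ^ 2 + u₃ x ^ 2) + (v₁ x ^ 2 + v₂ x ^ 2 + v₃ x ^ 2) / lam
          = (lam * u₁ x ^ 2 + v₁ x ^ 2 / lam) + (lam * u₂ x ^ 2 + v₂ x ^ 2 / lam)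
            + (lam * u₃ x ^ 2 + v₃ x ^ 2 / lam) := by
        field_simp; ring
      rw [e]; linarith
    have iP2 : IntegrableOn (fun x => 2 * (u₁ x * v₁ x + u₂ x * v₂ x + u₃ x * v₃ x)) S :=
      iP.const_mul 2
    have iAl : IntegrableOn (fun x => lam * (u₁ x ^ 2 + u₂ x ^ 2 + u₃ x ^ 2)) S := iA.const_mul lam
    have iBl : IntegrableOn (fun x => (v₁ x ^ 2 + v₂ x ^ 2 + v₃ x ^ 2) / lam) S := iB.div_const lam
    have iAB' : IntegrableOn (fun x => lam * (u₁ x ^ 2 + u₂ x ^ 2 + u₃ x ^ 2)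
        + (v₁ x ^ 2 + v₂ x ^ 2 + v₃ x ^ 2) / lam) S := iAl.add iBl
    calc 2 * P = ∫ x in S, 2 * (u₁ x * v₁ x + u₂ x * v₂ x + u₃ x * v₃ x) := by
          rw [MeasureTheory.integral_const_mul]
      _ ≤ ∫ x in S, (lam * (u₁ x ^ 2 + u₂ x ^ 2 + u₃ x ^ 2)
            + (v₁ x ^ 2 + v₂ x ^ 2 + v₃ x ^ 2) / lam) :=
          setIntegral_mono_on iP2 iAB' hS fun x _ => hpt x
      _ = lam * A + B / lam := by
          rw [integral_add iAl iBl, MeasureTheory.integral_const_mul, MeasureTheory.integral_div]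
  -- conclude
  rw [hexp]
  have hle : A + B + 2 * P ≤ (Real.sqrt A + Real.sqrt B) ^ 2 := by
    rw [add_sq, Real.sq_sqrt hA0, Real.sq_sqrt hB0]
    linarith
  calc Real.sqrt (A + B + 2 * P) ≤ Real.sqrt ((Real.sqrt A + Real.sqrt B) ^ 2) := Real.sqrt_le_sqrt hle
    _ = Real.sqrt A + Real.sqrt B := Real.sqrt_sq (by positivity)

/-- **The square root of the wave energy of Cauchy data is subadditive.** For `W ≥ 0` continuous,
`h₁, h₂ ∈ C¹`, `g₁, g₂` continuous with `hᵢ'², W hᵢ², gᵢ²` integrable on a measurable `S`: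
`√E[(h₁+h₂, g₁+g₂)] ≤ √E[(h₁,g₁)] + √E[(h₂,g₂)]`, `E[(h,g)] = ∫_S h'² + W h² + g²`. [folklore] -/
theorem sqrt_energy_add_le {W h₁ h₂ g₁ g₂ : ℝ → ℝ} (hW : Continuous W) (hW0 : ∀ x, 0 ≤ W x)
    (hh₁ : ContDiff ℝ 1 h₁) (hh₂ : ContDiff ℝ 1 h₂) (hg₁ : Continuous g₁) (hg₂ : Continuous g₂)
    {S : Set ℝ} (hS : MeasurableSet S)
    (i₁ : IntegrableOn (fun x => deriv h₁ x ^ 2) S) (i₂ : IntegrableOn (fun x => W x * h₁ x ^ 2) S)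
    (i₃ : IntegrableOn (fun x => g₁ x ^ 2) S) (j₁ : IntegrableOn (fun x => deriv h₂ x ^ 2) S)
    (j₂ : IntegrableOn (fun x => W x * h₂ x ^ 2) S) (j₃ : IntegrableOn (fun x => g₂ x ^ 2) S) :
    IntegrableOn (fun x => deriv (fun y => h₁ y + h₂ y) x ^ 2 + W x * (h₁ x + h₂ x) ^ 2
        + (g₁ x + g₂ x) ^ 2) S ∧
    Real.sqrt (∫ x in S, (deriv (fun y => h₁ y + h₂ y) x ^ 2 + W x * (h₁ x + h₂ x) ^ 2
        + (g₁ x + g₂ x) ^ 2))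
      ≤ Real.sqrt (∫ x in S, (deriv h₁ x ^ 2 + W x * h₁ x ^ 2 + g₁ x ^ 2))
        + Real.sqrt (∫ x in S, (deriv h₂ x ^ 2 + W x * h₂ x ^ 2 + g₂ x ^ 2)) := by
  have hd₁ : Continuous (deriv h₁) := hh₁.continuous_deriv le_rfl
  have hd₂ : Continuous (deriv h₂) := hh₂.continuous_deriv le_rfl
  have hsW : Continuous fun x => Real.sqrt (W x) := Real.continuous_sqrt.comp hW
  have hsq : ∀ x, Real.sqrt (W x) ^ 2 = W x := fun x => Real.sq_sqrt (hW0 x)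
  -- the second component `√W h`
  have e₁ : (fun x => W x * h₁ x ^ 2) = fun x => (Real.sqrt (W x) * h₁ x) ^ 2 := by
    funext x; rw [mul_pow, hsq]
  have e₂ : (fun x => W x * h₂ x ^ 2) = fun x => (Real.sqrt (W x) * h₂ x) ^ 2 := by
    funext x; rw [mul_pow, hsq]
  rw [e₁] at i₂
  rw [e₂] at j₂
  have hderiv : ∀ x, deriv (fun y => h₁ y + h₂ y) x = deriv h₁ x + deriv h₂ x := fun x =>
    deriv_fun_add ((hh₁.differentiable one_ne_zero) x) ((hh₂.differentiable one_ne_zero) x)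
  have hmain := sqrt_integral_sum_sq_add_le hd₁ (hsW.mul hh₁.continuous) hg₁ hd₂
    (hsW.mul hh₂.continuous) hg₂ hS i₁ i₂ i₃ j₁ j₂ j₃
  have hfun : (fun x => deriv (fun y => h₁ y + h₂ y) x ^ 2 + W x * (h₁ x + h₂ x) ^ 2
      + (g₁ x + g₂ x) ^ 2) = fun x => (deriv h₁ x + deriv h₂ x) ^ 2
        + (Real.sqrt (W x) * h₁ x + Real.sqrt (W x) * h₂ x) ^ 2 + (g₁ x + g₂ x) ^ 2 := by
    funext x; rw [hderiv x, ← mul_add, mul_pow, hsq]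
  have hA : (fun x => deriv h₁ x ^ 2 + W x * h₁ x ^ 2 + g₁ x ^ 2)
      = fun x => deriv h₁ x ^ 2 + (Real.sqrt (W x) * h₁ x) ^ 2 + g₁ x ^ 2 := by
    funext x; rw [mul_pow, hsq]
  have hB : (fun x => deriv h₂ x ^ 2 + W x * h₂ x ^ 2 + g₂ x ^ 2)
      = fun x => deriv h₂ x ^ 2 + (Real.sqrt (W x) * h₂ x) ^ 2 + g₂ x ^ 2 := by
    funext x; rw [mul_pow, hsq]
  rw [hfun, hA, hB]
  exact hmain

end Literature.Analysis.PDE
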